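import Literature.MathematicalPhysics.QuantumLattice.XXZInfiniteVolumeEquilibriumStates
import HarnessLib

/-!
# dKMS (energy–entropy-balance) states of a lattice interaction: convexity, weak⋆-closedness, and the
# zero-temperature limit (limits of dKMS states as `β → ∞` are ground states)

For a finite-range interaction `Φ` on the quantum spin system over `ℤ^d`, `InfVolState.IsDKMSState ω Φ R β`
(`HeisenbergAFInfiniteVolumeThermalStates.lean`) is Araki–Moriya's differential KMS condition (= the Sewell /
Roepstorff–Araki–Sewell energy–entropy balance inequalities, Bratteli–Robinson II Thm. 5.3.15).  Because `(C-2)` is the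
supremum of the LINEAR tangent rows `θ ω(AᴴA) − e^{θ−1} ω(AAᴴ) ≤ −iβ ω(Ãᴴ δA)` (`IsDKMSState.tangent_le`,
`XXZKT.eeb_clauses_of_tangent`), the dKMS states at `β` behave like the KMS states (Bratteli–Robinson II Thm. 5.3.30):

* `InfVolState.IsDKMSState.of_tangent` — `(C-1)` plus all tangent rows ⇒ dKMS;
* `InfVolState.IsDKMSState.mix`, `dKMSStates_convex` — the dKMS states at `β` form a convex set;
* `InfVolState.IsDKMSState.of_tendsto` — a pointwise (weak⋆ on every local algebra) limit of dKMS states at inverse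
  temperatures `β_k → β` is a dKMS state at `β` (weak⋆-closedness);
* `InfVolState.IsGroundState.of_isDKMSState_tendsto_atTop` — **the zero-temperature limit**: a pointwise limit of
  dKMS states at `β_k → +∞` is an infinite-volume ground state (`InfVolState.IsGroundState`; Bratteli–Kishimoto–Robinson
  1978 §I: "if `ω_β` is a family of `(τ, β)`-KMS states which is weak⋆-convergent as `β → ∞` then the limit state is a
  `τ`-ground state", proved there via the Sewell condition — which is exactly what is formalised here).

WHAT THIS IS NOT: dKMS ⟺ KMS is cited (Bratteli–Robinson II Thm. 5.3.15), not formalised; no compactness / Choquet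
simplex statement.

## References
* [BratteliKishimotoRobinson1978] O. Bratteli, A. Kishimoto, D. W. Robinson, *Ground states of quantum spin systems*,
  CMP **64** (1978) 41–48, §I (p. 41).
* [BratteliRobinsonII1997] O. Bratteli, D. W. Robinson, *OAQSM 2*, Thm. 5.3.15, Def. 5.3.18, Thm. 5.3.30.
* [ArakiMoriya2003] H. Araki, H. Moriya, Rev. Math. Phys. 15 (2003) 93, Def. 6.3.
* [FawziFawziScalet2024] H. Fawzi, O. Fawzi, S. O. Scalet, arXiv:2311.18706, Thm. 3.1 and the remark after it
  (`β = ∞`: the ground-state condition).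
-/

noncomputable section

namespace Literature.MathematicalPhysics.QuantumLattice

open Matrix Finset _root_.Filter Literature.Probability.LatticeModels
open scoped _root_.Topology ComplexOrder

variable {d q : ℕ}

namespace InfVolState

variable {Φ : LatticeInteraction d q} {R β : ℝ}

/-- `Re ω(AᴴA) ≥ 0`. [cite: BratteliRobinsonII1997, §6.2.1] -/
theorem re_expect_conjTranspose_mul_self_nonneg (ω : InfVolState d q) (Λ : Finset (Site d)) (A : Op ↥Λ q) :
    0 ≤ (ω.expect Λ (Aᴴ * A)).re :=
  (Complex.nonneg_iff.1 (ω.expect_nonneg Λ A)).1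

/-- `Re ω(AAᴴ) ≥ 0`. [cite: BratteliRobinsonII1997, §6.2.1] -/
theorem re_expect_mul_conjTranspose_self_nonneg (ω : InfVolState d q) (Λ : Finset (Site d)) (A : Op ↥Λ q) :
    0 ≤ (ω.expect Λ (A * Aᴴ)).re := by
  have := ω.expect_nonneg Λ Aᴴ
  rw [conjTranspose_conjTranspose] at this
  exact (Complex.nonneg_iff.1 this).1

open scoped Matrix.Norms.L2Operator in
/-- `Re ω(AAᴴ) ≤ ‖AAᴴ‖` (states are contractive). [cite: BratteliRobinsonI1987, Prop. 2.3.11] -/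
theorem re_expect_mul_conjTranspose_self_le_norm (ω : InfVolState d q) (Λ : Finset (Site d)) (A : Op ↥Λ q) :
    (ω.expect Λ (A * Aᴴ)).re ≤ ‖A * Aᴴ‖ :=
  (Complex.re_le_norm _).trans (ω.norm_expect_le_holds Λ (A * Aᴴ))

/-- **dKMS from `(C-1)` and the tangent rows**: if `Re ω(Ãᴴ δA) = 0` and
`θ·Re ω(AᴴA) − e^{θ−1}·Re ω(AAᴴ) ≤ β·Re(−i ω(Ãᴴ δA))` for every local `A` and every real `θ`, then `ω` is a dKMS state at
`β` — the rows' supremum over `θ` is `(C-2)` with its `+∞`-clause (`XXZKT.eeb_clauses_of_tangent`).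
[cite: ArakiMoriya2003, Def 6.3] [cite: FawziFawziScalet2024, Thm. 3.1 (5)] -/
theorem IsDKMSState.of_tangent {ω : InfVolState d q}
    (h1 : ∀ (Λ : Finset (Site d)) (A : Op ↥Λ q),
      (ω.expect (thicken Λ R) ((embedOp (subset_thicken Λ R) A)ᴴ * derivation Φ R Λ A)).re = 0)
    (ht : ∀ (Λ : Finset (Site d)) (A : Op ↥Λ q) (θ : ℝ),
      θ * (ω.expect Λ (Aᴴ * A)).re - Real.exp (θ - 1) * (ω.expect Λ (A * Aᴴ)).re ≤
        β * (-Complex.I * ω.expect (thicken Λ R) ((embedOp (subset_thicken Λ R) A)ᴴ * derivation Φ R Λ A)).re) :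
    ω.IsDKMSState Φ R β := by
  intro Λ A
  obtain ⟨h2, h3⟩ := XXZKT.eeb_clauses_of_tangent (ω.re_expect_conjTranspose_mul_self_nonneg Λ A)
    (ω.re_expect_mul_conjTranspose_self_nonneg Λ A) (ht Λ A)
  exact ⟨h1 Λ A, h2, h3⟩

/-- Real part of a convex combination of expectations rotated by `−i`. [folklore] -/
private theorem re_negI_mul_mix (t : ℝ) (z₁ z₂ : ℂ) :
    (-Complex.I * ((t : ℂ) * z₁ + ((1 - t : ℝ) : ℂ) * z₂)).re =
      t * (-Complex.I * z₁).re + (1 - t) * (-Complex.I * z₂).re := by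
  rw [mul_add, mul_left_comm (-Complex.I) (t : ℂ) z₁, mul_left_comm (-Complex.I) ((1 - t : ℝ) : ℂ) z₂,
    Complex.add_re, Complex.re_ofReal_mul, Complex.re_ofReal_mul]

/-- **Convex combinations of dKMS states are dKMS states** (all defining rows are linear in `ω` once `(C-2)` is
replaced by its tangent family). [cite: BratteliRobinsonII1997, Thm. 5.3.30 (1)] [cite: ArakiMoriya2003, Def 6.3] -/
theorem IsDKMSState.mix {ω₁ ω₂ : InfVolState d q} (h₁ : ω₁.IsDKMSState Φ R β) (h₂ : ω₂.IsDKMSState Φ R β)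
    (t : ℝ) (ht₀ : 0 ≤ t) (ht₁ : t ≤ 1) : (InfVolState.mix t ht₀ ht₁ ω₁ ω₂).IsDKMSState Φ R β := by
  refine IsDKMSState.of_tangent (fun Λ A => ?_) (fun Λ A θ => ?_)
  · rw [mix_expect, Complex.add_re, Complex.re_ofReal_mul, Complex.re_ofReal_mul,
      h₁.re_expect_conjTranspose_mul_derivation Λ A, h₂.re_expect_conjTranspose_mul_derivation Λ A, mul_zero,
      mul_zero, add_zero]
  · have r1 := h₁.tangent_le Λ A θ
    have r2 := h₂.tangent_le Λ A θ
    rw [mix_expect, mix_expect, mix_expect, re_negI_mul_mix, Complex.add_re, Complex.add_re,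
      Complex.re_ofReal_mul, Complex.re_ofReal_mul, Complex.re_ofReal_mul, Complex.re_ofReal_mul]
    have ht₁' : 0 ≤ 1 - t := sub_nonneg.2 ht₁
    nlinarith [mul_le_mul_of_nonneg_left r1 ht₀, mul_le_mul_of_nonneg_left r2 ht₁']

end InfVolState

/-- The set of dKMS (energy–entropy-balance) states of `Φ` (range `R`) at inverse temperature `β`.
[cite: ArakiMoriya2003, Def 6.3] [cite: BratteliRobinsonII1997, Thm. 5.3.30] -/
def dKMSStates (Φ : LatticeInteraction d q) (R β : ℝ) : Set (InfVolState d q) :=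
  {ω | ω.IsDKMSState Φ R β}

/-- Membership in `dKMSStates`. [cite: ArakiMoriya2003, Def 6.3] -/
theorem mem_dKMSStates_iff {Φ : LatticeInteraction d q} {R β : ℝ} {ω : InfVolState d q} :
    ω ∈ dKMSStates Φ R β ↔ ω.IsDKMSState Φ R β :=
  Iff.rfl

/-- **The dKMS states at `β` form a convex set.** [cite: BratteliRobinsonII1997, Thm. 5.3.30 (1)] -/
theorem dKMSStates_convex {Φ : LatticeInteraction d q} {R β : ℝ} {ω₁ ω₂ : InfVolState d q}
    (h₁ : ω₁ ∈ dKMSStates Φ R β) (h₂ : ω₂ ∈ dKMSStates Φ R β) (t : ℝ) (ht₀ : 0 ≤ t) (ht₁ : t ≤ 1) :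
    InfVolState.mix t ht₀ ht₁ ω₁ ω₂ ∈ dKMSStates Φ R β :=
  InfVolState.IsDKMSState.mix h₁ h₂ t ht₀ ht₁

namespace InfVolState

variable {Φ : LatticeInteraction d q} {R : ℝ}

/-- **Weak⋆-closedness of the dKMS states**: if `ω_k` is a dKMS state at `β_k`, `β_k → β`, and `ω_k → ω` on every local
algebra, then `ω` is a dKMS state at `β` (the tangent rows and `(C-1)` are closed conditions).
[cite: BratteliRobinsonII1997, Thm. 5.3.30 (1) and Thm. 5.3.25] [cite: ArakiMoriya2003, Def 6.3] -/
theorem IsDKMSState.of_tendsto {ωk : ℕ → InfVolState d q} {βk : ℕ → ℝ} {β : ℝ} {ω : InfVolState d q}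
    (hk : ∀ k, (ωk k).IsDKMSState Φ R (βk k)) (hβ : Tendsto βk atTop (𝓝 β))
    (hlim : ∀ (Λ : Finset (Site d)) (A : Op ↥Λ q), Tendsto (fun k => (ωk k).expect Λ A) atTop (𝓝 (ω.expect Λ A))) :
    ω.IsDKMSState Φ R β := by
  refine IsDKMSState.of_tangent (fun Λ A => ?_) (fun Λ A θ => ?_)
  · have h := (Complex.continuous_re.tendsto _).comp
      (hlim (thicken Λ R) ((embedOp (subset_thicken Λ R) A)ᴴ * derivation Φ R Λ A))
    rw [show ((fun z : ℂ => z.re) ∘ fun k => (ωk k).expect (thicken Λ R)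
        ((embedOp (subset_thicken Λ R) A)ᴴ * derivation Φ R Λ A)) = fun _ => (0 : ℝ) from
      funext fun k => (hk k).re_expect_conjTranspose_mul_derivation Λ A] at h
    exact tendsto_nhds_unique h tendsto_const_nhds
  · have hu := (Complex.continuous_re.tendsto _).comp (hlim Λ (Aᴴ * A))
    have hv := (Complex.continuous_re.tendsto _).comp (hlim Λ (A * Aᴴ))
    have hc := (Complex.continuous_re.tendsto _).comp
      ((hlim (thicken Λ R) ((embedOp (subset_thicken Λ R) A)ᴴ * derivation Φ R Λ A)).const_mul (-Complex.I))
    exact le_of_tendsto_of_tendsto' ((hu.const_mul θ).sub (hv.const_mul (Real.exp (θ - 1)))) (hβ.mul hc)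
      fun k => (hk k).tangent_le Λ A θ

open scoped Matrix.Norms.L2Operator in
/-- **THE ZERO-TEMPERATURE LIMIT OF dKMS STATES IS A GROUND STATE** (Bratteli–Kishimoto–Robinson 1978, §I, via the
Sewell condition): if `ω_k` is a dKMS state of `Φ` at inverse temperature `β_k`, `β_k → +∞`, and `ω_k → ω` on every local
algebra, then `ω` is an infinite-volume ground state of `Φ`: `−i ω(Ãᴴ δA) ≥ 0` for every local `A`.  Proof: `(C-1)`
passes to the limit (the imaginary part of `−i ω(Ãᴴ δA)` vanishes), and the tangent row at `θ = 0`,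
`−e^{−1} Re ω_k(AAᴴ) ≤ β_k Re(−i ω_k(Ãᴴ δA))` with `Re ω_k(AAᴴ) ≤ ‖AAᴴ‖`, gives `Re(−i ω_k(Ãᴴ δA)) ≥ −e^{−1}‖AAᴴ‖/β_k → 0`.
[cite: BratteliKishimotoRobinson1978, §I (p. 41)] [cite: BratteliRobinsonII1997, Def. 5.3.18]
[cite: FawziFawziScalet2024, remark after Thm. 3.1] -/
theorem IsGroundState.of_isDKMSState_tendsto_atTop {ωk : ℕ → InfVolState d q} {βk : ℕ → ℝ} {ω : InfVolState d q}
    (hk : ∀ k, (ωk k).IsDKMSState Φ R (βk k)) (hβ : Tendsto βk atTop atTop)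
    (hlim : ∀ (Λ : Finset (Site d)) (A : Op ↥Λ q), Tendsto (fun k => (ωk k).expect Λ A) atTop (𝓝 (ω.expect Λ A))) :
    ω.IsGroundState Φ R := by
  intro Λ A
  set X : Op ↥(thicken Λ R) q := (embedOp (subset_thicken Λ R) A)ᴴ * derivation Φ R Λ A with hX
  -- `(C-1)` in the limit: `Re ω(X) = 0`
  have hre : (ω.expect (thicken Λ R) X).re = 0 := by
    have h := (Complex.continuous_re.tendsto _).comp (hlim (thicken Λ R) X)
    rw [show ((fun z : ℂ => z.re) ∘ fun k => (ωk k).expect (thicken Λ R) X) = fun _ => (0 : ℝ) from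
      funext fun k => (hk k).re_expect_conjTranspose_mul_derivation Λ A] at h
    exact tendsto_nhds_unique h tendsto_const_nhds
  -- the real part: `Re(−i ω(X)) ≥ 0`
  have hc : Tendsto (fun k => (-Complex.I * (ωk k).expect (thicken Λ R) X).re) atTop
      (𝓝 (-Complex.I * ω.expect (thicken Λ R) X).re) :=
    (Complex.continuous_re.tendsto _).comp ((hlim (thicken Λ R) X).const_mul (-Complex.I))
  have hlow : Tendsto (fun k => -(Real.exp (-1) * ‖A * Aᴴ‖) * (βk k)⁻¹) atTop (𝓝 0) := by
    simpa using (tendsto_inv_atTop_zero.comp hβ).const_mul (-(Real.exp (-1) * ‖A * Aᴴ‖))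
  have hev : ∀ᶠ k in atTop, -(Real.exp (-1) * ‖A * Aᴴ‖) * (βk k)⁻¹ ≤
      (-Complex.I * (ωk k).expect (thicken Λ R) X).re := by
    filter_upwards [hβ.eventually_gt_atTop 0] with k hkpos
    have hrow : -(Real.exp (-1) * ((ωk k).expect Λ (A * Aᴴ)).re) ≤
        βk k * (-Complex.I * (ωk k).expect (thicken Λ R) X).re := by
      have h0 := (hk k).tangent_le Λ A 0
      rw [zero_mul, zero_sub, zero_sub] at h0
      exact h0
    have hv := (ωk k).re_expect_mul_conjTranspose_self_le_norm Λ A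
    rw [← div_eq_mul_inv, div_le_iff₀ hkpos]
    have he : 0 < Real.exp (-1) := Real.exp_pos _
    nlinarith [mul_le_mul_of_nonneg_left hv he.le]
  have hc0 : 0 ≤ (-Complex.I * ω.expect (thicken Λ R) X).re := le_of_tendsto_of_tendsto hlow hc hev
  refine Complex.nonneg_iff.2 ⟨hc0, ?_⟩
  simp [Complex.mul_im, hre]

/-- The zero-temperature limit, in `groundStates` / `dKMSStates` form. [cite: BratteliKishimotoRobinson1978, §I (p. 41)] -/
theorem mem_groundStates_of_dKMSStates_tendsto_atTop {ωk : ℕ → InfVolState d q} {βk : ℕ → ℝ}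
    {ω : InfVolState d q} (hk : ∀ k, ωk k ∈ dKMSStates Φ R (βk k)) (hβ : Tendsto βk atTop atTop)
    (hlim : ∀ (Λ : Finset (Site d)) (A : Op ↥Λ q), Tendsto (fun k => (ωk k).expect Λ A) atTop (𝓝 (ω.expect Λ A))) :
    ω ∈ groundStates Φ R :=
  IsGroundState.of_isDKMSState_tendsto_atTop hk hβ hlim

/-- **Zero-temperature limits exist**: from every sequence of dKMS states at `β_k → ∞` one can extract a pointwise
convergent subsequence (`InfVolState.exists_tendsto_expect_subseq`), whose limit is then a ground state.
[cite: BratteliKishimotoRobinson1978, §I (p. 41)] [cite: BratteliRobinsonI1987, Thm. 2.3.15] -/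
theorem exists_groundState_of_dKMSStates_atTop {ωk : ℕ → InfVolState d q} {βk : ℕ → ℝ}
    (hk : ∀ k, (ωk k).IsDKMSState Φ R (βk k)) (hβ : Tendsto βk atTop atTop) :
    ∃ φ : ℕ → ℕ, StrictMono φ ∧ ∃ ω : InfVolState d q, ω.IsGroundState Φ R ∧
      ∀ (Λ : Finset (Site d)) (A : Op ↥Λ q), Tendsto (fun k => (ωk (φ k)).expect Λ A) atTop (𝓝 (ω.expect Λ A)) := by
  obtain ⟨φ, hφ, ω, hlim⟩ := InfVolState.exists_tendsto_expect_subseq ωk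
  exact ⟨φ, hφ, ω, IsGroundState.of_isDKMSState_tendsto_atTop (fun k => hk (φ k))
    (hβ.comp hφ.tendsto_atTop) hlim, hlim⟩

end InfVolState

end Literature.MathematicalPhysics.QuantumLattice

end
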